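import Summits.CriticalPhenomena.PercolationContinuityZ3.Theorems.PercNearOneGluingNoHeavyLowerTailSahiGridPatternDiagCertLiteralTwoAnd

/-!
# `NoHeavyLowerTail` (crux stmt-CriticalPhenomena-4575), Sahi programme P1: **DIAGONAL CERTIFICATES PROPAGATE THROUGH THE THRESHOLD-2 LITERAL-OR STEP** —
# if `d ≥ 0` certifies `V ⊆ [3]^k` then `d' = (2^k·1_V + d, 2^k·1_V + d, 2^{k+1} + 2h_V)` certifies `{x₀ = 2} ∨ [3]×V ⊆ [3]^{1+k}` (every `k`)

Support file (Sahi cell, seat `prim-sahi-p1`, generation 33; `--supports stmt-CriticalPhenomena-4575`).  Pure proofs, no definitions, no `sorry`,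
standard axioms.  Vocabulary of `…SahiGridPattern{,CellForm,SliceForm,RectCert,DiagCert}` (`Pd`, `sStarD`, `glue`, `sect`, `cellOf`, `freeOf`, `ind`,
`TotDist`, `thirdPt`, `lamU`, `thetaVal`, `nuCount`, `cylSet`); tools of `…DiagCertLiteralAnd` / `…DiagCertLiteralOr` / `…CylinderOneAxis` (generation 28) and the
Latin-role symmetrisation lemma `sum_sum_eq_of_latin6_eq` of `…DiagCertLiteralTwoAnd` (this generation).

THE MATHEMATICS.  A DIAGONAL CERTIFICATE of an up-set `U ⊆ [3]^k` (`…SahiGridPatternDiagCert`) is `d : [3]^k → ℤ`, `d ≥ 0`, with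
(T) `Σ_{q∈W} d(q) ≤ Σ_{q∈W} λ_U(q)` for every up-set `W` and (N) `Σ_{q∈P, r∈Q} Θ_U(q,r) ≤ Σ_{q∈P∩Q} d(q)` for all up-sets `P, Q`; it proves
`U × [3]^n` good in every dimension (`sStarD_cylSet_nonneg_of_diagCert`).
**THEOREM (`diagCert_literalTwoOr_T`, `diagCert_literalTwoOr_N`, every `k`).**  Let `V ⊆ [3]^k` be an up-set with diagonal certificate `d ≥ 0`, let
`h_V = 2^k·1_V − ν_V` (the Harris density) and `A = {x ∈ [3]^{1+k} : x₀ = 2 ∨ tail x ∈ V}` (`glue ξ z ∈ A ↔ 2 ≤ ξ 0 ∨ z ∈ V`).  Then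
   `d'(x) = 2^k·1_V(tail x) + d(tail x)` if `x₀ ≤ 1`,   `d'(x) = 2^{k+1} + 2h_V(tail x)` if `x₀ = 2`
is a diagonal certificate of `A` in dimension `1+k`: (T') and (N') hold and `d' ≥ 0`, so (`sStarD_cylSet_literalTwoOr_nonneg_of_diagCert`) `A × [3]^n` is a
good first slot for every `n`.  PROOF = two identities (found by the generation-28 symbolic LP `nest2.py`, certificate `cert2_T1.json`, re-verified exactly by
this seat on random instances and as a polynomial identity after Latin-role symmetrisation, then proved here):
  (T')  `λ_A(W') − d'(W') = [λ_V(W₀) − d(W₀)] + [λ_V(W₁) − d(W₁)] + 2^k Σ_q (1−1_V(q))(2·1_{W₂} − 1_{W₀} − 1_{W₁})(q)`,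
  (N')  `d'(B∩C) − Θ_A(B×C) = [d(B₀∩C₁) − Θ_V(B₀×C₁)] + [d(B₁∩C₀) − Θ_V(B₁×C₀)] + Σ_q d(q)(1_{B₁}−1_{B₀})(1_{C₁}−1_{C₀})(q)
          + 2Σ_q (1−1_V(q))·K_{C₂}(q;B₂) + H(B₂, C₀∩V) + H(B₂, C₁∩V) + H(C₂, B₀∩V) + H(C₂, B₁∩V)
          + Σ_{q δ̸ r} 1_V(q)[(1_{B₂}−1_{B₀})(1_{C₂}−1_{C₀}) + (1_{B₂}−1_{B₁})(1_{C₂}−1_{C₁})](q)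
          + Σ_{q δ̸ r} (1−1_V(q))[(1_{B₂}−1_{B₀})(r)(1_{C₂}−1_{C₁})(q̄r) + (1_{B₂}−1_{B₁})(r)(1_{C₂}−1_{C₀})(q̄r)]`,
  where `K_Q(q;X) = Σ_{r δ̸ q} 1_X(r)(1_Q(r) − 1_Q(q̄r)) ≥ 0` is Kleitman's inequality in the cube around `q` and `H(P,Q) = 2^k·#(P∩Q) − N(P;Q) ≥ 0` is
  coefficientwise Harris; every bracket is `≥ 0` by (N), (T), modularity (`d ≥ 0`, nested sections), Kleitman, Harris.
With `…DiagCertLiteralAnd` (`{x₀≥1}∧V`), `…DiagCertLiteralOr` (`{x₀≥1}∨V`) and `…DiagCertLiteralTwoAnd` (`{x₀=2}∧V`), this completes the certificate calculus of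
the seat memo FROM-prim-sahi-p1-gen28 §3bis in Lean: the class of DIAGONALLY CERTIFIED up-sets is closed under ALL FOUR one-axis literal steps, the cylinder
(`…DiagCertLift`) and block-AND with a top-cube first block (`…DiagRouteTopCubeCert`).  Nothing here asserts `PatternPos d` for `d ≥ 4`. [this work]
-/

namespace Summit.CriticalPhenomena.PercolationContinuityZ3.Theorems.SahiGridPattern

open Finset SahiGrid3
open scoped BigOperators

variable {k : ℕ}

/-- Section increments of an up-set of `[3]^{1+k}` along the free axis are nonnegative. -/
private theorem ind_glue_sub_nonneg₃ {B : Finset (Pd (1 + k))} (hB : IsUpperSet (B : Set (Pd (1 + k)))) {s t : Fin 3} (hst : s ≤ t)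
    (q : Pd k) : 0 ≤ ind B (glue (fun _ : Fin 1 => t) q) - ind B (glue (fun _ : Fin 1 => s) q) := by
  unfold ind
  by_cases h : glue (fun _ : Fin 1 => s) q ∈ B
  · rw [if_pos h, if_pos (mem_of_glue_mem_of_le hB hst h)]; norm_num
  · rw [if_neg h]; split_ifs <;> norm_num

variable {V : Finset (Pd k)} {A : Finset (Pd (1 + k))}

/-! ### The glued set `{x₀ = 2} ∨ V`: indicator, `ν` and `λ` by levels -/

/-- Indicator of `A = {x₀ = 2} ∨ V` at a glued point. [this work] -/
theorem ind_glue_literalTwoOr (hA : ∀ ξ z, glue ξ z ∈ A ↔ (2 ≤ ξ 0 ∨ z ∈ V)) (ξ : Pd 1) (z : Pd k) :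
    ind A (glue ξ z) = if 2 ≤ ξ 0 then 1 else ind V z := by
  unfold ind
  simp only [hA]
  by_cases h1 : 2 ≤ ξ 0 <;> by_cases h2 : z ∈ V <;> simp [h1, h2]

/-- Levels `0` and `1` of `A` are `V`, level `2` is everything. [this work] -/
theorem ind_glue_literalTwoOr_levels (hA : ∀ ξ z, glue ξ z ∈ A ↔ (2 ≤ ξ 0 ∨ z ∈ V)) (z : Pd k) :
    ind A (glue (fun _ => 0) z) = ind V z ∧ ind A (glue (fun _ => 1) z) = ind V z ∧ ind A (glue (fun _ => 2) z) = 1 := by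
  refine ⟨?_, ?_, ?_⟩
  · rw [ind_glue_literalTwoOr hA]; simp [show ¬ ((2:Fin 3) ≤ 0) by decide]
  · rw [ind_glue_literalTwoOr hA]; simp [show ¬ ((2:Fin 3) ≤ 1) by decide]
  · rw [ind_glue_literalTwoOr hA]; simp

/-- `λ_A` at the three levels of `A = {x₀ = 2} ∨ V`: `λ_A(0,q) = λ_A(1,q) = 2^{k+2}1_V(q) − ν_V(q) − 2^k`, `λ_A(2,q) = 2^{k+2} − 2ν_V(q)`
(ν as a pair sum). [this work] -/
theorem lamU_literalTwoOr_levels (hA : ∀ ξ z, glue ξ z ∈ A ↔ (2 ≤ ξ 0 ∨ z ∈ V)) (q : Pd k) :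
    lamU A (glue (fun _ => 0) q) = 2 * 2 ^ (1 + k) * ind V q - (∑ r : Pd k, ind V r * (if TotDist r q = true then (1:ℤ) else 0)) - 2 ^ k
    ∧ lamU A (glue (fun _ => 1) q) = 2 * 2 ^ (1 + k) * ind V q - (∑ r : Pd k, ind V r * (if TotDist r q = true then (1:ℤ) else 0)) - 2 ^ k
    ∧ lamU A (glue (fun _ => 2) q) = 2 * 2 ^ (1 + k) - 2 * ∑ r : Pd k, ind V r * (if TotDist r q = true then (1:ℤ) else 0) := by
  obtain ⟨h00, h11, h22, h01, h02, h10, h12, h20, h21, -, -, -, -, -, -⟩ := pd1_facts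
  obtain ⟨i0, i1, i2⟩ := And.intro (fun z => (ind_glue_literalTwoOr_levels hA z).1)
    (And.intro (fun z => (ind_glue_literalTwoOr_levels hA z).2.1) (fun z => (ind_glue_literalTwoOr_levels hA z).2.2))
  have hpow : (∑ r : Pd k, (1:ℤ) * (if TotDist r q = true then (1:ℤ) else 0)) = 2 ^ k := by
    have e : (∑ r : Pd k, (1:ℤ) * (if TotDist r q = true then (1:ℤ) else 0)) = ∑ r : Pd k, (if TotDist q r = true then (1:ℤ) else 0) :=
      Finset.sum_congr rfl fun r _ => by rw [totDist_symm r q]; ring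
    rw [e, sum_ite_totDist_eq_two_pow]
  have e : ∀ ξ : Pd 1, (nuCount A (glue ξ q) : ℤ) =
      ((if TotDist (fun _ : Fin 1 => (0:Fin 3)) ξ = true then (1:ℤ) else 0) + (if TotDist (fun _ : Fin 1 => (1:Fin 3)) ξ = true then (1:ℤ) else 0))
        * (∑ r : Pd k, ind V r * (if TotDist r q = true then (1:ℤ) else 0))
      + (if TotDist (fun _ : Fin 1 => (2:Fin 3)) ξ = true then (1:ℤ) else 0) * 2 ^ k := by
    intro ξ
    rw [nuCount_glue_eq, sum_pd1]
    simp only [i0, i1, i2, hpow]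
    ring
  unfold lamU
  refine ⟨?_, ?_, ?_⟩
  · rw [e, i0]; simp only [h00, h10, h20, Bool.false_eq_true, if_false, if_true]; ring
  · rw [e, i1]; simp only [h01, h11, h21, Bool.false_eq_true, if_false, if_true]; ring
  · rw [e, i2]; simp only [h02, h12, h22, Bool.false_eq_true, if_false, if_true]; ring

/-! ### (T') -/

/-- **(T') for the threshold-2 literal-OR step**: if `d` satisfies (T) for `V`, then `d' = (2^k1_V + d, 2^k1_V + d, 2^{k+1} + 2h_V)` satisfies (T) for
`A = {x₀ = 2} ∨ V`: `Σ_{x∈W'} d'(x) ≤ Σ_{x∈W'} λ_A(x)` for every up-set `W' ⊆ [3]^{1+k}`; the slack is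
`[λ_V−d](W₀) + [λ_V−d](W₁) + 2^k Σ (1−1_V)(2·1_{W₂}−1_{W₀}−1_{W₁})`. [this work] -/
theorem diagCert_literalTwoOr_T (hA : ∀ ξ z, glue ξ z ∈ A ↔ (2 ≤ ξ 0 ∨ z ∈ V)) (d : Pd k → ℤ)
    (hT : ∀ W : Finset (Pd k), IsUpperSet (W : Set (Pd k)) → (∑ q ∈ W, d q) ≤ ∑ q ∈ W, lamU V q)
    (W' : Finset (Pd (1 + k))) (hW' : IsUpperSet (W' : Set (Pd (1 + k)))) :
    (∑ x ∈ W', (fun x => if freeOf x 0 = 2 then 2 * 2 ^ k + 2 * (2 ^ k * ind V (cellOf x) - (nuCount V (cellOf x) : ℤ))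
        else 2 ^ k * ind V (cellOf x) + d (cellOf x)) x) ≤ ∑ x ∈ W', lamU A x := by
  have hl := lamU_literalTwoOr_levels hA
  rw [sum_mem_eq_levels W' _, sum_mem_eq_levels W' (lamU A)]
  simp only [freeOf_glue, cellOf_glue, show ¬ ((0:Fin 3) = 2) by decide, show ¬ ((1:Fin 3) = 2) by decide, if_false, if_true]
  have hνeq : ∀ q : Pd k, (nuCount V q : ℤ) = ∑ r : Pd k, ind V r * (if TotDist r q = true then (1:ℤ) else 0) := fun q => nuCount_eq_sum_ind V q
  have hlamV : ∀ q : Pd k, lamU V q = 2 * 2 ^ k * ind V q - ∑ r : Pd k, ind V r * (if TotDist r q = true then (1:ℤ) else 0) := by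
    intro q; unfold lamU; rw [nuCount_eq_sum_ind]
  have p1 : (2:ℤ) ^ (1 + k) = 2 * 2 ^ k := by rw [pow_add, pow_one]
  -- (T) for V at the sections W₀, W₁
  have hT0 := hT (sect W' (fun _ => 0)) (isUpperSet_sect hW' _)
  have hT1 := hT (sect W' (fun _ => 1)) (isUpperSet_sect hW' _)
  rw [sum_mem_eq_sum_ind_mul, sum_mem_eq_sum_ind_mul (sect W' _) (lamU V)] at hT0 hT1
  simp only [ind_sect] at hT0 hT1
  -- the three λ-levels rewritten
  have e0 : (∑ q : Pd k, ind W' (glue (fun _ => 0) q) * lamU A (glue (fun _ => 0) q))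
      = (∑ q : Pd k, ind W' (glue (fun _ => 0) q) * lamU V q) + ∑ q : Pd k, ind W' (glue (fun _ => 0) q) * (2 * 2 ^ k * ind V q - 2 ^ k) := by
    rw [← Finset.sum_add_distrib]
    refine Finset.sum_congr rfl fun q _ => ?_
    rw [(hl q).1, hlamV q, p1]; ring
  have e1 : (∑ q : Pd k, ind W' (glue (fun _ => 1) q) * lamU A (glue (fun _ => 1) q))
      = (∑ q : Pd k, ind W' (glue (fun _ => 1) q) * lamU V q) + ∑ q : Pd k, ind W' (glue (fun _ => 1) q) * (2 * 2 ^ k * ind V q - 2 ^ k) := by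
    rw [← Finset.sum_add_distrib]
    refine Finset.sum_congr rfl fun q _ => ?_
    rw [(hl q).2.1, hlamV q, p1]; ring
  have e2 : (∑ q : Pd k, ind W' (glue (fun _ => 2) q) * lamU A (glue (fun _ => 2) q))
      = ∑ q : Pd k, ind W' (glue (fun _ => 2) q) * (4 * 2 ^ k - 2 * (nuCount V q : ℤ)) := by
    refine Finset.sum_congr rfl fun q _ => ?_
    rw [(hl q).2.2, hνeq q, p1]; ring
  -- the two d-levels split
  have l0 : (∑ q : Pd k, ind W' (glue (fun _ => 0) q) * (2 ^ k * ind V q + d q))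
      = (∑ q : Pd k, ind W' (glue (fun _ => 0) q) * d q) + ∑ q : Pd k, ind W' (glue (fun _ => 0) q) * (2 ^ k * ind V q) := by
    rw [← Finset.sum_add_distrib]; refine Finset.sum_congr rfl fun q _ => ?_; ring
  have l1 : (∑ q : Pd k, ind W' (glue (fun _ => 1) q) * (2 ^ k * ind V q + d q))
      = (∑ q : Pd k, ind W' (glue (fun _ => 1) q) * d q) + ∑ q : Pd k, ind W' (glue (fun _ => 1) q) * (2 ^ k * ind V q) := by
    rw [← Finset.sum_add_distrib]; refine Finset.sum_congr rfl fun q _ => ?_; ring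
  rw [e0, e1, e2, l0, l1]
  -- the pointwise slack 2^k(1 − 1_V)(2·1_{W₂} − 1_{W₀} − 1_{W₁}) ≥ 0
  have hn02 := fun q => ind_glue_sub_nonneg₃ hW' (show (0:Fin 3) ≤ 2 by decide) q
  have hn12 := fun q => ind_glue_sub_nonneg₃ hW' (show (1:Fin 3) ≤ 2 by decide) q
  have hV1 : ∀ q : Pd k, ind V q ≤ 1 := fun q => ind_le_one' V q
  have hW1 : ∀ q : Pd k, ind W' (glue (fun _ => (2:Fin 3)) q) ≤ 1 := fun q => ind_le_one' W' _
  have hpos : (0:ℤ) < 2 ^ k := by positivity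
  have hνle : ∀ q : Pd k, (nuCount V q : ℤ) ≤ 2 ^ k := fun q => nuCount_le_two_pow V q
  have k0 : 0 ≤ (∑ q : Pd k, ind W' (glue (fun _ => 0) q) * (2 * 2 ^ k * ind V q - 2 ^ k))
      - (∑ q : Pd k, ind W' (glue (fun _ => 0) q) * (2 ^ k * ind V q))
      + ((∑ q : Pd k, ind W' (glue (fun _ => 1) q) * (2 * 2 ^ k * ind V q - 2 ^ k))
      - (∑ q : Pd k, ind W' (glue (fun _ => 1) q) * (2 ^ k * ind V q)))
      + ((∑ q : Pd k, ind W' (glue (fun _ => 2) q) * (4 * 2 ^ k - 2 * (nuCount V q : ℤ)))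
      - (∑ q : Pd k, ind W' (glue (fun _ => 2) q) * (2 * 2 ^ k + 2 * (2 ^ k * ind V q - (nuCount V q : ℤ))))) := by
    rw [← Finset.sum_sub_distrib, ← Finset.sum_sub_distrib, ← Finset.sum_sub_distrib, ← Finset.sum_add_distrib, ← Finset.sum_add_distrib]
    refine Finset.sum_nonneg fun q _ => ?_
    have c : 0 ≤ 1 - ind V q := by have := hV1 q; linarith
    have t0 : 0 ≤ (2:ℤ) ^ k * ((1 - ind V q) * (ind W' (glue (fun _ => 2) q) - ind W' (glue (fun _ => 0) q))) :=
      mul_nonneg hpos.le (mul_nonneg c (hn02 q))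
    have t1 : 0 ≤ (2:ℤ) ^ k * ((1 - ind V q) * (ind W' (glue (fun _ => 2) q) - ind W' (glue (fun _ => 1) q))) :=
      mul_nonneg hpos.le (mul_nonneg c (hn12 q))
    nlinarith [t0, t1]
  linarith

/-! ### (N') -/

/-- **(N') for the threshold-2 literal-OR step**: if `d ≥ 0` satisfies (N) for the up-set `V`, then `d' = (2^k1_V + d, 2^k1_V + d, 2^{k+1} + 2h_V)`
satisfies (N) for `A = {x₀ = 2} ∨ V`: `Σ_{x∈B, y∈C} Θ_A(x,y) ≤ Σ_{x∈B∩C} d'(x)` for all up-sets `B, C ⊆ [3]^{1+k}`.  Proof: a 12-column identity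
(two certificate hypotheses, modularity, Kleitman, Harris, pointwise) valid after Latin-role symmetrisation. [this work] -/
theorem diagCert_literalTwoOr_N (hV : IsUpperSet (V : Set (Pd k))) (hA : ∀ ξ z, glue ξ z ∈ A ↔ (2 ≤ ξ 0 ∨ z ∈ V)) (d : Pd k → ℤ)
    (hd : ∀ q, 0 ≤ d q)
    (hN : ∀ P Q : Finset (Pd k), IsUpperSet (P : Set (Pd k)) → IsUpperSet (Q : Set (Pd k)) →
      (∑ q ∈ P, ∑ r ∈ Q, thetaVal V q r) ≤ ∑ q ∈ P ∩ Q, d q)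
    (B C : Finset (Pd (1 + k))) (hB : IsUpperSet (B : Set (Pd (1 + k)))) (hC : IsUpperSet (C : Set (Pd (1 + k)))) :
    (∑ x ∈ B, ∑ y ∈ C, thetaVal A x y) ≤ ∑ x ∈ B ∩ C, (fun x => if freeOf x 0 = 2 then 2 * 2 ^ k + 2 * (2 ^ k * ind V (cellOf x) - (nuCount V (cellOf x) : ℤ))
        else 2 ^ k * ind V (cellOf x) + d (cellOf x)) x := by
  obtain ⟨i0, i1, i2⟩ := And.intro (fun z => (ind_glue_literalTwoOr_levels hA z).1)
    (And.intro (fun z => (ind_glue_literalTwoOr_levels hA z).2.1) (fun z => (ind_glue_literalTwoOr_levels hA z).2.2))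
  have hl := lamU_literalTwoOr_levels hA
  have eS := sStarD_eq_sum_lamU_sub_sum_thetaVal A B C
  suffices key : (∑ x ∈ B ∩ C, lamU A x) - (∑ x ∈ B ∩ C, (fun x => if freeOf x 0 = 2 then 2 * 2 ^ k + 2 * (2 ^ k * ind V (cellOf x) - (nuCount V (cellOf x) : ℤ))
        else 2 ^ k * ind V (cellOf x) + d (cellOf x)) x) ≤ sStarD A B C by
    linarith
  have hνeq : ∀ q : Pd k, (nuCount V q : ℤ) = ∑ r : Pd k, ind V r * (if TotDist r q = true then (1:ℤ) else 0) := fun q => nuCount_eq_sum_ind V q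
  have p1 : (2:ℤ) ^ (1 + k) = 2 * 2 ^ k := by rw [pow_add, pow_one]
  -- conversions of the q-local quantities into totally-distinct pair sums
  have c4 : ∀ q : Pd k, (2:ℤ) * 2 ^ (1 + k) * ind V q = ∑ r : Pd k, (if TotDist q r = true then (1:ℤ) else 0) * (4 * ind V q) := by
    intro q; rw [← Finset.sum_mul, sum_ite_totDist_eq_two_pow, p1]; ring
  have c4' : ∀ q : Pd k, (2:ℤ) * 2 ^ (1 + k) = ∑ r : Pd k, (if TotDist q r = true then (1:ℤ) else 0) * 4 := by
    intro q; rw [← Finset.sum_mul, sum_ite_totDist_eq_two_pow, p1]; ring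
  have ck : ∀ q : Pd k, (2:ℤ) ^ k = ∑ r : Pd k, (if TotDist q r = true then (1:ℤ) else 0) * 1 := by
    intro q; rw [← Finset.sum_mul, sum_ite_totDist_eq_two_pow]; ring
  have cν : ∀ q : Pd k, (∑ r : Pd k, ind V r * (if TotDist r q = true then (1:ℤ) else 0))
      = ∑ r : Pd k, (if TotDist q r = true then (1:ℤ) else 0) * ind V r := by
    intro q; refine Finset.sum_congr rfl fun r _ => ?_; rw [totDist_symm r q]; ring
  -- λ_A(B∩C) as a pair sum
  have L1 : (∑ x ∈ B ∩ C, lamU A x)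
      = ∑ q : Pd k, ∑ r : Pd k, (if TotDist q r = true then (1:ℤ) else 0) *
          ( ind B (glue (fun _ => 0) q) * ind C (glue (fun _ => 0) q) * (4 * ind V q - ind V r - 1)
            + ind B (glue (fun _ => 1) q) * ind C (glue (fun _ => 1) q) * (4 * ind V q - ind V r - 1)
            + ind B (glue (fun _ => 2) q) * ind C (glue (fun _ => 2) q) * (4 - 2 * ind V r) ) := by
    rw [sum_mem_eq_levels]
    simp only [ind_inter_eq_mul]
    rw [← Finset.sum_add_distrib, ← Finset.sum_add_distrib]
    refine Finset.sum_congr rfl fun q _ => ?_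
    rw [(hl q).1, (hl q).2.1, (hl q).2.2, c4 q, c4' q, cν q, ck q]
    simp only [Finset.mul_sum, ← Finset.sum_sub_distrib, ← Finset.sum_add_distrib]
    refine Finset.sum_congr rfl fun r _ => ?_
    ring
  -- d'(B∩C) = pair-sum part + d part
  have L2 : (∑ x ∈ B ∩ C, (fun x => if freeOf x 0 = 2 then 2 * 2 ^ k + 2 * (2 ^ k * ind V (cellOf x) - (nuCount V (cellOf x) : ℤ))
        else 2 ^ k * ind V (cellOf x) + d (cellOf x)) x)
      = (∑ q : Pd k, ∑ r : Pd k, (if TotDist q r = true then (1:ℤ) else 0) *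
          ( ind B (glue (fun _ => 0) q) * ind C (glue (fun _ => 0) q) * ind V q
            + ind B (glue (fun _ => 1) q) * ind C (glue (fun _ => 1) q) * ind V q
            + ind B (glue (fun _ => 2) q) * ind C (glue (fun _ => 2) q) * (2 + 2 * ind V q - 2 * ind V r) ))
        + ∑ q : Pd k, (ind B (glue (fun _ => 0) q) * ind C (glue (fun _ => 0) q) + ind B (glue (fun _ => 1) q) * ind C (glue (fun _ => 1) q)) * d q := by
    rw [sum_mem_eq_levels]
    simp only [ind_inter_eq_mul, freeOf_glue, cellOf_glue, show ¬ ((0:Fin 3) = 2) by decide, show ¬ ((1:Fin 3) = 2) by decide,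
      if_false, if_true]
    rw [← Finset.sum_add_distrib, ← Finset.sum_add_distrib, ← Finset.sum_add_distrib]
    refine Finset.sum_congr rfl fun q _ => ?_
    have h2k := sum_ite_totDist_eq_two_pow q
    have ex : (∑ r : Pd k, (if TotDist q r = true then (1:ℤ) else 0) *
          ( ind B (glue (fun _ => 0) q) * ind C (glue (fun _ => 0) q) * ind V q
            + ind B (glue (fun _ => 1) q) * ind C (glue (fun _ => 1) q) * ind V q
            + ind B (glue (fun _ => 2) q) * ind C (glue (fun _ => 2) q) * (2 + 2 * ind V q - 2 * ind V r) ))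
        = (ind B (glue (fun _ => 0) q) * ind C (glue (fun _ => 0) q) * ind V q
            + ind B (glue (fun _ => 1) q) * ind C (glue (fun _ => 1) q) * ind V q
            + ind B (glue (fun _ => 2) q) * ind C (glue (fun _ => 2) q) * (2 + 2 * ind V q)) * 2 ^ k
          - 2 * (ind B (glue (fun _ => 2) q) * ind C (glue (fun _ => 2) q))
            * ∑ r : Pd k, (if TotDist q r = true then (1:ℤ) else 0) * ind V r := by
      rw [← h2k, Finset.mul_sum, Finset.mul_sum, ← Finset.sum_sub_distrib]
      exact Finset.sum_congr rfl fun r _ => by ring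
    rw [ex, hνeq q, cν q]
    ring
  -- the pattern functional of A, one axis explicit, sections of A substituted
  have L3 := sStarD_eq_pd1_sections A B C
  simp only [i0, i1, i2] at L3
  -- hypotheses (N) at the section pairs (B₀,C₁), (B₁,C₀), in pair-sum form
  have hN01 := hN (sect B (fun _ => 0)) (sect C (fun _ => 1)) (isUpperSet_sect hB _) (isUpperSet_sect hC _)
  have hN10 := hN (sect B (fun _ => 1)) (sect C (fun _ => 0)) (isUpperSet_sect hB _) (isUpperSet_sect hC _)
  rw [sum_sum_thetaVal_eq_pairSum, sum_mem_eq_sum_ind_mul (sect B _ ∩ sect C _)] at hN01 hN10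
  simp only [ind_inter_eq_mul, ind_sect] at hN01 hN10
  -- nonnegative columns
  have hB01 := fun q => ind_glue_sub_nonneg₃ hB (show (0:Fin 3) ≤ 1 by decide) q
  have hB02 := fun q => ind_glue_sub_nonneg₃ hB (show (0:Fin 3) ≤ 2 by decide) q
  have hB12 := fun q => ind_glue_sub_nonneg₃ hB (show (1:Fin 3) ≤ 2 by decide) q
  have hC01 := fun q => ind_glue_sub_nonneg₃ hC (show (0:Fin 3) ≤ 1 by decide) q
  have hC02 := fun q => ind_glue_sub_nonneg₃ hC (show (0:Fin 3) ≤ 2 by decide) q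
  have hC12 := fun q => ind_glue_sub_nonneg₃ hC (show (1:Fin 3) ≤ 2 by decide) q
  have hcV : ∀ q : Pd k, 0 ≤ 1 - ind V q := fun q => by have := ind_le_one' V q; linarith
  have hVn : ∀ q : Pd k, 0 ≤ ind V q := fun q => ind_nonneg' V q
  -- modularity of d on the nested sections (levels 0,1)
  have M : 0 ≤ ∑ q : Pd k, d q * ((ind B (glue (fun _ => 1) q) - ind B (glue (fun _ => 0) q)) * (ind C (glue (fun _ => 1) q) - ind C (glue (fun _ => 0) q))) :=
    Finset.sum_nonneg fun q _ => mul_nonneg (hd q) (mul_nonneg (hB01 q) (hC01 q))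
  have Dpart : (∑ q : Pd k, (ind B (glue (fun _ => 0) q) * ind C (glue (fun _ => 0) q) + ind B (glue (fun _ => 1) q) * ind C (glue (fun _ => 1) q)) * d q)
      = (∑ q : Pd k, ind B (glue (fun _ => 0) q) * ind C (glue (fun _ => 1) q) * d q)
        + (∑ q : Pd k, ind B (glue (fun _ => 1) q) * ind C (glue (fun _ => 0) q) * d q)
        + ∑ q : Pd k, d q * ((ind B (glue (fun _ => 1) q) - ind B (glue (fun _ => 0) q)) * (ind C (glue (fun _ => 1) q) - ind C (glue (fun _ => 0) q))) := by
    rw [← Finset.sum_add_distrib, ← Finset.sum_add_distrib]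
    refine Finset.sum_congr rfl fun q _ => ?_; ring
  -- Kleitman (weight 1 − 1_V), Harris ×4, pointwise ×4
  have W1 := weighted_kleitman_nonneg₂ (isUpperSet_sect hB (fun _ => 2)) (isUpperSet_sect hC (fun _ => 2)) _ hcV
  have hC0V : IsUpperSet ((sect C (fun _ : Fin 1 => (0:Fin 3)) ∩ V : Finset (Pd k)) : Set (Pd k)) := by
    rw [Finset.coe_inter]; exact (isUpperSet_sect hC _).inter hV
  have hC1V : IsUpperSet ((sect C (fun _ : Fin 1 => (1:Fin 3)) ∩ V : Finset (Pd k)) : Set (Pd k)) := by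
    rw [Finset.coe_inter]; exact (isUpperSet_sect hC _).inter hV
  have hB0V : IsUpperSet ((sect B (fun _ : Fin 1 => (0:Fin 3)) ∩ V : Finset (Pd k)) : Set (Pd k)) := by
    rw [Finset.coe_inter]; exact (isUpperSet_sect hB _).inter hV
  have hB1V : IsUpperSet ((sect B (fun _ : Fin 1 => (1:Fin 3)) ∩ V : Finset (Pd k)) : Set (Pd k)) := by
    rw [Finset.coe_inter]; exact (isUpperSet_sect hB _).inter hV
  have H1 := harris_pair_nonneg (isUpperSet_sect hB (fun _ => 2)) hC0V
  have H2 := harris_pair_nonneg (isUpperSet_sect hB (fun _ => 2)) hC1V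
  have H3 := harris_pair_nonneg (isUpperSet_sect hC (fun _ => 2)) hB0V
  have H4 := harris_pair_nonneg (isUpperSet_sect hC (fun _ => 2)) hB1V
  simp only [ind_sect, ind_inter_eq_mul] at W1 H1 H2 H3 H4
  have P1 : 0 ≤ ∑ q : Pd k, ∑ r : Pd k, (if TotDist q r = true then (1:ℤ) else 0) *
      (ind V q * ((ind B (glue (fun _ => 2) q) - ind B (glue (fun _ => 0) q)) * (ind C (glue (fun _ => 2) q) - ind C (glue (fun _ => 0) q)))) :=
    Finset.sum_nonneg fun q _ => Finset.sum_nonneg fun r _ => mul_nonneg (by split_ifs <;> norm_num)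
      (mul_nonneg (hVn q) (mul_nonneg (hB02 q) (hC02 q)))
  have P2 : 0 ≤ ∑ q : Pd k, ∑ r : Pd k, (if TotDist q r = true then (1:ℤ) else 0) *
      (ind V q * ((ind B (glue (fun _ => 2) q) - ind B (glue (fun _ => 1) q)) * (ind C (glue (fun _ => 2) q) - ind C (glue (fun _ => 1) q)))) :=
    Finset.sum_nonneg fun q _ => Finset.sum_nonneg fun r _ => mul_nonneg (by split_ifs <;> norm_num)
      (mul_nonneg (hVn q) (mul_nonneg (hB12 q) (hC12 q)))
  have P3 : 0 ≤ ∑ q : Pd k, ∑ r : Pd k, (if TotDist q r = true then (1:ℤ) else 0) *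
      ((1 - ind V q) * ((ind B (glue (fun _ => 2) r) - ind B (glue (fun _ => 0) r)) * (ind C (glue (fun _ => 2) (thirdPt q r)) - ind C (glue (fun _ => 1) (thirdPt q r))))) :=
    Finset.sum_nonneg fun q _ => Finset.sum_nonneg fun r _ => mul_nonneg (by split_ifs <;> norm_num)
      (mul_nonneg (hcV q) (mul_nonneg (hB02 r) (hC12 (thirdPt q r))))
  have P4 : 0 ≤ ∑ q : Pd k, ∑ r : Pd k, (if TotDist q r = true then (1:ℤ) else 0) *
      ((1 - ind V q) * ((ind B (glue (fun _ => 2) r) - ind B (glue (fun _ => 1) r)) * (ind C (glue (fun _ => 2) (thirdPt q r)) - ind C (glue (fun _ => 0) (thirdPt q r))))) :=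
    Finset.sum_nonneg fun q _ => Finset.sum_nonneg fun r _ => mul_nonneg (by split_ifs <;> norm_num)
      (mul_nonneg (hcV q) (mul_nonneg (hB12 r) (hC02 (thirdPt q r))))
  -- the pair-sum identity (valid after symmetrisation over the six Latin roles):
  --   sStarD − L1 + (pair part of L2) + Θ_V(B₀×C₁) + Θ_V(B₁×C₀) = 2·W1 + H1 + H2 + H3 + H4 + P1 + P2 + P3 + P4
  have PairId : sStarD A B C
      - (∑ q : Pd k, ∑ r : Pd k, (if TotDist q r = true then (1:ℤ) else 0) *
          ( ind B (glue (fun _ => 0) q) * ind C (glue (fun _ => 0) q) * (4 * ind V q - ind V r - 1)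
            + ind B (glue (fun _ => 1) q) * ind C (glue (fun _ => 1) q) * (4 * ind V q - ind V r - 1)
            + ind B (glue (fun _ => 2) q) * ind C (glue (fun _ => 2) q) * (4 - 2 * ind V r) ))
      + (∑ q : Pd k, ∑ r : Pd k, (if TotDist q r = true then (1:ℤ) else 0) *
          ( ind B (glue (fun _ => 0) q) * ind C (glue (fun _ => 0) q) * ind V q
            + ind B (glue (fun _ => 1) q) * ind C (glue (fun _ => 1) q) * ind V q
            + ind B (glue (fun _ => 2) q) * ind C (glue (fun _ => 2) q) * (2 + 2 * ind V q - 2 * ind V r) ))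
      + (∑ q : Pd k, ∑ r : Pd k, (if TotDist q r = true then (1:ℤ) else 0) *
          (ind B (glue (fun _ => 0) q) * ind C (glue (fun _ => 1) r) * (ind V q + ind V r - ind V (thirdPt q r))))
      + (∑ q : Pd k, ∑ r : Pd k, (if TotDist q r = true then (1:ℤ) else 0) *
          (ind B (glue (fun _ => 1) q) * ind C (glue (fun _ => 0) r) * (ind V q + ind V r - ind V (thirdPt q r))))
      = 2 * (∑ q : Pd k, ∑ r : Pd k, (if TotDist q r = true then (1:ℤ) else 0) *
          ((1 - ind V q) * (ind B (glue (fun _ => 2) r) * (ind C (glue (fun _ => 2) r) - ind C (glue (fun _ => 2) (thirdPt q r))))))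
      + (∑ q : Pd k, ∑ r : Pd k, (if TotDist q r = true then (1:ℤ) else 0) *
          (ind B (glue (fun _ => 2) q) * (ind C (glue (fun _ => 0) q) * ind V q - ind C (glue (fun _ => 0) r) * ind V r)))
      + (∑ q : Pd k, ∑ r : Pd k, (if TotDist q r = true then (1:ℤ) else 0) *
          (ind B (glue (fun _ => 2) q) * (ind C (glue (fun _ => 1) q) * ind V q - ind C (glue (fun _ => 1) r) * ind V r)))
      + (∑ q : Pd k, ∑ r : Pd k, (if TotDist q r = true then (1:ℤ) else 0) *
          (ind C (glue (fun _ => 2) q) * (ind B (glue (fun _ => 0) q) * ind V q - ind B (glue (fun _ => 0) r) * ind V r)))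
      + (∑ q : Pd k, ∑ r : Pd k, (if TotDist q r = true then (1:ℤ) else 0) *
          (ind C (glue (fun _ => 2) q) * (ind B (glue (fun _ => 1) q) * ind V q - ind B (glue (fun _ => 1) r) * ind V r)))
      + (∑ q : Pd k, ∑ r : Pd k, (if TotDist q r = true then (1:ℤ) else 0) *
          (ind V q * ((ind B (glue (fun _ => 2) q) - ind B (glue (fun _ => 0) q)) * (ind C (glue (fun _ => 2) q) - ind C (glue (fun _ => 0) q)))))
      + (∑ q : Pd k, ∑ r : Pd k, (if TotDist q r = true then (1:ℤ) else 0) *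
          (ind V q * ((ind B (glue (fun _ => 2) q) - ind B (glue (fun _ => 1) q)) * (ind C (glue (fun _ => 2) q) - ind C (glue (fun _ => 1) q)))))
      + (∑ q : Pd k, ∑ r : Pd k, (if TotDist q r = true then (1:ℤ) else 0) *
          ((1 - ind V q) * ((ind B (glue (fun _ => 2) r) - ind B (glue (fun _ => 0) r)) * (ind C (glue (fun _ => 2) (thirdPt q r)) - ind C (glue (fun _ => 1) (thirdPt q r))))))
      + (∑ q : Pd k, ∑ r : Pd k, (if TotDist q r = true then (1:ℤ) else 0) *
          ((1 - ind V q) * ((ind B (glue (fun _ => 2) r) - ind B (glue (fun _ => 1) r)) * (ind C (glue (fun _ => 2) (thirdPt q r)) - ind C (glue (fun _ => 0) (thirdPt q r)))))) := by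
    rw [L3]
    simp only [Finset.mul_sum, ← Finset.sum_add_distrib, ← Finset.sum_sub_distrib]
    refine sum_sum_eq_of_latin6_eq _ _ fun q r => ?_
    obtain ⟨t1, t2, t3, t4, t5, c1, c2, c3, c4, c5⟩ := latin6_norm (k := k) q r
    simp only [t1, t2, t3, t4, t5, c1, c2, c3, c4, c5]
    ring
  rw [L1, L2, Dpart]
  linarith [PairId, W1, H1, H2, H3, H4, P1, P2, P3, P4, hN01, hN10, M]

/-- The certificate `d'` is pointwise nonnegative when `d ≥ 0`. [this work] -/
theorem diagCert_literalTwoOr_nonneg (d : Pd k → ℤ) (hd : ∀ q, 0 ≤ d q) (x : Pd (1 + k)) :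
    0 ≤ (fun x => if freeOf x 0 = 2 then 2 * 2 ^ k + 2 * (2 ^ k * ind V (cellOf x) - (nuCount V (cellOf x) : ℤ))
        else 2 ^ k * ind V (cellOf x) + d (cellOf x)) x := by
  show 0 ≤ (if freeOf x 0 = 2 then 2 * 2 ^ k + 2 * (2 ^ k * ind V (cellOf x) - (nuCount V (cellOf x) : ℤ))
        else 2 ^ k * ind V (cellOf x) + d (cellOf x))
  have h1 := ind_nonneg' V (cellOf x)
  have h2 := nuCount_le_two_pow V (cellOf x)
  have h3 : (0:ℤ) ≤ 2 ^ k := by positivity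
  have h4 := hd (cellOf x)
  split_ifs
  · nlinarith
  · nlinarith

/-- **THE THRESHOLD-2 LITERAL-OR STEP PRESERVES DIAGONAL CERTIFIABILITY, hence goodness in EVERY dimension**: if the up-set `V ⊆ [3]^k` has a
diagonal certificate `d ≥ 0` and `A = {x₀ = 2} ∨ V ⊆ [3]^{1+k}`, then `A × [3]^n` is a good first slot for all `n`. [this work] -/
theorem sStarD_cylSet_literalTwoOr_nonneg_of_diagCert (hV : IsUpperSet (V : Set (Pd k))) (hA : ∀ ξ z, glue ξ z ∈ A ↔ (2 ≤ ξ 0 ∨ z ∈ V))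
    (d : Pd k → ℤ) (hd : ∀ q, 0 ≤ d q)
    (hT : ∀ W : Finset (Pd k), IsUpperSet (W : Set (Pd k)) → (∑ q ∈ W, d q) ≤ ∑ q ∈ W, lamU V q)
    (hN : ∀ P Q : Finset (Pd k), IsUpperSet (P : Set (Pd k)) → IsUpperSet (Q : Set (Pd k)) →
      (∑ q ∈ P, ∑ r ∈ Q, thetaVal V q r) ≤ ∑ q ∈ P ∩ Q, d q)
    {n : ℕ} {B C : Finset (Pd (n + (1 + k)))} (hB : IsUpperSet (B : Set (Pd (n + (1 + k))))) (hC : IsUpperSet (C : Set (Pd (n + (1 + k))))) :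
    0 ≤ sStarD (cylSet A : Finset (Pd (n + (1 + k)))) B C :=
  sStarD_cylSet_nonneg_of_diagCert A
    (fun x => if freeOf x 0 = 2 then 2 * 2 ^ k + 2 * (2 ^ k * ind V (cellOf x) - (nuCount V (cellOf x) : ℤ)) else 2 ^ k * ind V (cellOf x) + d (cellOf x))
    (fun x => diagCert_literalTwoOr_nonneg d hd x)
    (fun W' hW' => diagCert_literalTwoOr_T hA d hT W' hW')
    (fun P Q hP hQ => diagCert_literalTwoOr_N hV hA d hd hN P Q hP hQ) hB hC

/-- **The threshold-2 literal-OR step in the slot's own dimension**: (T), (N) for `V` with `d ≥ 0` give `0 ≤ sStarD A B C` for all up-sets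
`B, C ⊆ [3]^{1+k}`. [this work] -/
theorem sStarD_literalTwoOr_nonneg_of_diagCert (hV : IsUpperSet (V : Set (Pd k))) (hA : ∀ ξ z, glue ξ z ∈ A ↔ (2 ≤ ξ 0 ∨ z ∈ V))
    (d : Pd k → ℤ) (hd : ∀ q, 0 ≤ d q)
    (hT : ∀ W : Finset (Pd k), IsUpperSet (W : Set (Pd k)) → (∑ q ∈ W, d q) ≤ ∑ q ∈ W, lamU V q)
    (hN : ∀ P Q : Finset (Pd k), IsUpperSet (P : Set (Pd k)) → IsUpperSet (Q : Set (Pd k)) →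
      (∑ q ∈ P, ∑ r ∈ Q, thetaVal V q r) ≤ ∑ q ∈ P ∩ Q, d q)
    {B C : Finset (Pd (1 + k))} (hB : IsUpperSet (B : Set (Pd (1 + k)))) (hC : IsUpperSet (C : Set (Pd (1 + k)))) :
    0 ≤ sStarD A B C :=
  sStarD_nonneg_of_diagCert A
    (fun x => if freeOf x 0 = 2 then 2 * 2 ^ k + 2 * (2 ^ k * ind V (cellOf x) - (nuCount V (cellOf x) : ℤ)) else 2 ^ k * ind V (cellOf x) + d (cellOf x))
    (fun W' hW' => diagCert_literalTwoOr_T hA d hT W' hW')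
    (fun P Q hP hQ => diagCert_literalTwoOr_N hV hA d hd hN P Q hP hQ) hB hC

end Summit.CriticalPhenomena.PercolationContinuityZ3.Theorems.SahiGridPattern
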